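import Literature.MathematicalPhysics.QuantumFieldTheory.Balaban1983to89.LatticeFieldCalculus

/-!
# `Balaban1983to89.B5Eq121Form` — T. Bałaban, *Propagators and renormalization transformations for lattice gauge
theories. I*, Commun. Math. Phys. **95** (1984) 17–40 [Balaban1984PropagatorsI]: the displayed identity (1.21),
`⟨∂A, ∂A⟩ = Σ_μ ⟨A_μ, ΔA_μ⟩ − ⟨∂*A, ∂*A⟩`, proved on the V1 lattice calculus `LatticeFieldCalculus`

statement-level skeleton of published theorems with citation tags; proofs where landed; nothing here is a claim about the Yang–Mills mass gap

PDF held: `paper:balaban1984-cmp95-propagators-rt-i` (journal page = PDF page + 16; (1.21) is p. 21 = PDF p. 5, read on the page render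
`run/shared/lean/pub/pub-balaban/b2b-balaban-ref1/pages/1984-cmp95-propagators-rt-I/…-p005-x4.png`).

WHAT IS REPRODUCED.  SKELETON rows `F13` (r18, cross-paper definitions: "the displayed identity (1.21): absent (Phase 2)") =
`B5.Eq1.21` (r02), Phase-2 seat p37 of PHASE2-TARGETS.md §G.3 (kind: identity, knitting G.2(b)).  The printed display, p. 21:

  «The action can be written as
     ⟨∂A, ∂A⟩ = ½ Σ_{x∈T_η,μ,ν} η^d |F_{μν}(x)|² = Σ_{x,μ,ν} η^d |(∂_μ A_ν)(x)|² − Σ_{x,μ,ν} η^d (∂_μ A_ν)(x)(∂_ν A_μ)(x)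
              = Σ_μ ⟨∂A_μ, ∂A_μ⟩ − Σ_x η^d |Σ_μ (∂*_μ A_μ)(x)|² = Σ_μ ⟨A_μ, ΔA_μ⟩ − ⟨∂*A, ∂*A⟩,                          (1.21)
   where Δ is η-lattice Laplace operator for scalar functions and ∂* is the divergence operator for vector functions,
   ∂*A = Σ_μ ∂*_μ A_μ.»

Every one of the four printed equalities is a theorem below, on the carriers OF RECORD of the series' shared vocabulary (`Setup`:
`Site P j`, `PBond P j`, `Plaq P j`, `SiteField`, `VecField`) and the V1 calculus of `LatticeFieldCalculus` (forward difference
`pdiff c μ` = `∂_μ`, its `ℓ²`-adjoint `pdiffAdj c μ` = `∂*_μ`, `grad c` = `∂` on scalar functions, `curl c` = `∂` on vector functions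
(the plaquette variable `F(p)`, (1.2)), `diverg c` = `∂*`, `laplace c` = `Δ = Σ_μ ∂*_μ ∂_μ`, the pairings `sitePairing w`/`bondPairing w`
with the volume element `w = η^d`, and the action `curlAction w c` = `S^η = ½⟨∂A, ∂A⟩` of (1.3)/(1.5)); the lattice factor `c = η⁻¹`
and the weight `w = η^d` are arbitrary reals throughout (nothing depends on their values).  Dictionary for the five members of (1.21):
* `⟨∂A, ∂A⟩` = `∑ p : Plaq P j, w * (curl c A p) ^ 2` (the pairing of plaquette functions, "similarly for functions defined at bonds
  or plaquettes", B7 (18); = `2 * curlAction w c A`, theorem `two_mul_curlAction_eq`);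
* `F_{μν}(x)` for an ORDERED pair `(μ, ν)` = `pdiff c μ (fun z => A ⟨z, ν⟩) x - pdiff c ν (fun z => A ⟨z, μ⟩) x` (= `(∂_μ A_ν)(x) −
  (∂_ν A_μ)(x)`, (1.2); for `μ < ν` this is `curl c A ⟨x, μ, ν, _⟩`, `LatticeFieldCalculus.curl_eq_pdiff`);
* `A_μ` = the site function `fun z => A ⟨z, μ⟩` ((1.1)); `⟨∂A_μ, ∂A_μ⟩` = `bondPairing w (grad c A_μ) (grad c A_μ)`;
  `⟨A_μ, ΔA_μ⟩` = `sitePairing w A_μ (laplace c A_μ)`; `⟨∂*A, ∂*A⟩` = `sitePairing w (diverg c A) (diverg c A)`.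
The proof is the printed one: antisymmetry `F_{νμ} = −F_{μν}`, `F_{μμ} = 0` (first `=`); expanding the square (second `=`); summation
by parts `Σ_x (∂_μ f) g = Σ_x f (∂*_μ g)` (`LatticeFieldCalculus.sum_pdiff_mul`) twice together with the commutation `∂*_μ ∂_ν = ∂_ν ∂*_μ`
of lattice translations for the cross term, and `Σ_b (∂f)(b) B(b) = Σ_x f (∂*B)` (`sum_grad_mul`) with `∂*∂ = Δ` (`diverg_grad`) for
the last `=`.  Real-valued fields, as in [Balaban1984PropagatorsI] §1 (the pairings of `LatticeFieldCalculus` are typed for real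
fields); the whole torus `T^{(j)}` (no boundary terms), every level `j`, every `Params`.

RELATION TO EXISTING TREE MATERIAL (not duplicated): the same display is certified on the momentum/matrix carrier `Tor N × Fin d → ℂ`
in `B5Action121` (`action_identity_121`, `curl_adjoint_curl`; row `B5.Eq1.21` proved-existing there); this file is the V1 (`Setup` /
`LatticeFieldCalculus`) version the cross-paper definitions pass asked for (SKELETON-r18 F13), so that statements typed over `Plaq P j` /
`VecField P j` can cite (1.21) by name.  No new definition is introduced.

Unit `lit-balaban-p37` (Phase-2 proof seat p37), HOME `run/shared/lean/pub/lit-balaban/` (STATUS: `lit-balaban-p37/STATUS.md`), 2026-08-21.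
-/

open scoped BigOperators

namespace Literature.MathematicalPhysics.QuantumFieldTheory.Balaban1983to89

namespace B5Eq121Form

open LatticeFieldCalculus

variable {P : Params} {j : ℕ}

/-! ## 0. Helpers: site translations commute; sums over bonds and plaquettes as iterated sums -/

/-- `(x + e_μ)_μ = x_μ + 1`. [folklore] -/
private theorem shift_apply_self (x : Site P j) (μ : Fin P.d) : x.shift μ μ = x μ + 1 := by
  simp [Site.shift]

/-- `(x + e_μ)_κ = x_κ`, `κ ≠ μ`. [folklore] -/
private theorem shift_apply_ne (x : Site P j) {μ κ : Fin P.d} (h : κ ≠ μ) : x.shift μ κ = x κ := by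
  simp [Site.shift, Function.update_of_ne h]

/-- `(x − e_μ)_μ = x_μ − 1`. [folklore] -/
private theorem unshift_apply_self (x : Site P j) (μ : Fin P.d) : x.unshift μ μ = x μ - 1 := by
  simp [Site.unshift]

/-- `(x − e_μ)_κ = x_κ`, `κ ≠ μ`. [folklore] -/
private theorem unshift_apply_ne (x : Site P j) {μ κ : Fin P.d} (h : κ ≠ μ) : x.unshift μ κ = x κ := by
  simp [Site.unshift, Function.update_of_ne h]

/-- Lattice translations commute: `(x + e_ν) − e_μ = (x − e_μ) + e_ν`. [folklore] -/
private theorem unshift_shift_comm (x : Site P j) (μ ν : Fin P.d) :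
    (x.shift ν).unshift μ = (x.unshift μ).shift ν := by
  funext κ
  by_cases h1 : κ = μ
  · subst h1
    by_cases h2 : κ = ν
    · subst h2
      rw [unshift_apply_self, shift_apply_self, shift_apply_self, unshift_apply_self]
      ring
    · rw [unshift_apply_self, shift_apply_ne _ h2, shift_apply_ne _ h2, unshift_apply_self]
  · by_cases h2 : κ = ν
    · subst h2
      rw [unshift_apply_ne _ h1, shift_apply_self, shift_apply_self, unshift_apply_ne _ h1]
    · rw [unshift_apply_ne _ h1, shift_apply_ne _ h2, shift_apply_ne _ h2, unshift_apply_ne _ h1]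

/-- `∂*_μ ∂_ν = ∂_ν ∂*_μ` (translations of the torus commute). [folklore] -/
private theorem pdiffAdj_pdiff_comm (c : ℝ) (μ ν : Fin P.d) (f : SiteField P j ℝ) :
    pdiffAdj c μ (pdiff c ν f) = pdiff c ν (pdiffAdj c μ f) := by
  funext x
  simp only [pdiffAdj, pdiff, smul_eq_mul, unshift_shift_comm]
  ring

/-- A sum over positively oriented bonds is a double sum over sites and directions. [folklore] -/
private theorem sum_bond_eq {α : Type*} [AddCommMonoid α] (F : PBond P j → α) :
    ∑ b : PBond P j, F b = ∑ x : Site P j, ∑ μ : Fin P.d, F ⟨x, μ⟩ :=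
  calc ∑ b : PBond P j, F b = ∑ p : Site P j × Fin P.d, F (bondEquiv p) :=
        (Equiv.sum_comp (bondEquiv (P := P) (j := j)) F).symm
    _ = ∑ x : Site P j, ∑ μ : Fin P.d, F ⟨x, μ⟩ := Fintype.sum_prod_type _

/-- A sum over positively oriented plaquettes `p = p_{μν}(x)`, `μ < ν`, is the sum over sites and over the ordered pairs `μ < ν`.
[folklore] -/
private theorem sum_plaq_eq {α : Type*} [AddCommMonoid α] (G : Site P j → Fin P.d → Fin P.d → α) :
    ∑ p : Plaq P j, G p.src p.μ p.ν
      = ∑ x : Site P j, ∑ μ : Fin P.d, ∑ ν : Fin P.d, if μ < ν then G x μ ν else 0 := by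
  have h1 : (∑ x : Site P j, ∑ μ : Fin P.d, ∑ ν : Fin P.d, if μ < ν then G x μ ν else 0)
      = ∑ t : Site P j × Fin P.d × Fin P.d, if t.2.1 < t.2.2 then G t.1 t.2.1 t.2.2 else 0 := by
    rw [Fintype.sum_prod_type]
    refine Finset.sum_congr rfl fun x _ => ?_
    rw [Fintype.sum_prod_type]
  have h2 : (∑ t : Site P j × Fin P.d × Fin P.d, if t.2.1 < t.2.2 then G t.1 t.2.1 t.2.2 else 0)
      = ∑ t ∈ (Finset.univ.filter fun t : Site P j × Fin P.d × Fin P.d => t.2.1 < t.2.2), G t.1 t.2.1 t.2.2 := by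
    rw [Finset.sum_filter]
  have h3 : (∑ t ∈ (Finset.univ.filter fun t : Site P j × Fin P.d × Fin P.d => t.2.1 < t.2.2), G t.1 t.2.1 t.2.2)
      = ∑ t : {t : Site P j × Fin P.d × Fin P.d // t.2.1 < t.2.2}, G t.1.1 t.1.2.1 t.1.2.2 := by
    apply Finset.sum_subtype
    intro t
    simp
  have h4 : (∑ t : {t : Site P j × Fin P.d × Fin P.d // t.2.1 < t.2.2}, G t.1.1 t.1.2.1 t.1.2.2)
      = ∑ p : Plaq P j, G p.src p.μ p.ν :=
    Fintype.sum_equiv ⟨fun t => ⟨t.1.1, t.1.2.1, t.1.2.2, t.2⟩, fun p => ⟨(p.src, p.μ, p.ν), p.hμν⟩, fun _ => rfl, fun _ => rfl⟩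
      _ _ fun _ => rfl
  rw [h1, h2, h3, h4]

/-! ## 1. First equality of (1.21): `⟨∂A, ∂A⟩ = ½ Σ_{x,μ,ν} η^d |F_{μν}(x)|²` (plaquettes `μ < ν` versus ordered pairs, by
`F_{νμ} = −F_{μν}`, `F_{μμ} = 0`) -/

/-- **(1.21), first equality** p. 21 [PDF 5], verbatim: *"⟨∂A, ∂A⟩ = ½ Σ_{x∈T_η,μ,ν} η^d |F_{μν}(x)|²"* — typed reading: the sum of
`η^d |(∂A)(p)|²` over the positively oriented plaquettes `p = p_{μν}(x)`, `μ < ν`, of `T^{(j)}` is one half of the sum over all sites and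
all ORDERED pairs `(μ, ν)` of `η^d |(∂_μ A_ν)(x) − (∂_ν A_μ)(x)|²`. [cite: Balaban1984PropagatorsI, (1.21) p.21] -/
theorem pairing_curl_eq_half_sum_sq (w c : ℝ) (A : VecField P j ℝ) :
    ∑ p : Plaq P j, w * (curl c A p) ^ 2
      = (1 / 2) * ∑ x : Site P j, ∑ μ : Fin P.d, ∑ ν : Fin P.d,
          w * (pdiff c μ (fun z => A ⟨z, ν⟩) x - pdiff c ν (fun z => A ⟨z, μ⟩) x) ^ 2 := by
  set g : Site P j → Fin P.d → Fin P.d → ℝ :=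
    fun x μ ν => w * (pdiff c μ (fun z => A ⟨z, ν⟩) x - pdiff c ν (fun z => A ⟨z, μ⟩) x) ^ 2 with hg
  have hcurl : ∀ p : Plaq P j, w * (curl c A p) ^ 2 = g p.src p.μ p.ν := fun p => by
    rw [hg, curl_eq_pdiff]
  have gsymm : ∀ x μ ν, g x μ ν = g x ν μ := fun x μ ν => by
    simp only [hg]
    ring
  have gdiag : ∀ x μ, g x μ μ = 0 := fun x μ => by
    simp only [hg]
    ring
  have key : ∀ x, ∑ μ, ∑ ν, g x μ ν = 2 * ∑ μ, ∑ ν, if μ < ν then g x μ ν else 0 := by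
    intro x
    have tri : ∀ μ ν, g x μ ν
        = (if μ < ν then g x μ ν else 0) + (if ν < μ then g x μ ν else 0) + (if μ = ν then g x μ ν else 0) := by
      intro μ ν
      rcases lt_trichotomy μ ν with h | h | h
      · simp [h, h.ne, lt_asymm h]
      · subst h
        simp
      · simp [h, h.ne', lt_asymm h]
    have h1 : ∑ μ, ∑ ν, (if ν < μ then g x μ ν else 0) = ∑ μ, ∑ ν, (if μ < ν then g x μ ν else 0) := by
      rw [Finset.sum_comm]
      exact Finset.sum_congr rfl fun μ _ => Finset.sum_congr rfl fun ν _ => by rw [gsymm x ν μ]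
    have h2 : ∑ μ, ∑ ν, (if μ = ν then g x μ ν else 0) = (0 : ℝ) := by
      simp [Finset.sum_ite_eq, gdiag]
    calc ∑ μ, ∑ ν, g x μ ν
        = ∑ μ, ∑ ν, ((if μ < ν then g x μ ν else 0) + (if ν < μ then g x μ ν else 0)
            + (if μ = ν then g x μ ν else 0)) :=
          Finset.sum_congr rfl fun μ _ => Finset.sum_congr rfl fun ν _ => tri μ ν
      _ = ∑ μ, ∑ ν, (if μ < ν then g x μ ν else 0) + ∑ μ, ∑ ν, (if ν < μ then g x μ ν else 0)
            + ∑ μ, ∑ ν, (if μ = ν then g x μ ν else 0) := by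
          simp only [Finset.sum_add_distrib]
      _ = 2 * ∑ μ, ∑ ν, if μ < ν then g x μ ν else 0 := by
          rw [h1, h2]
          ring
  calc ∑ p : Plaq P j, w * (curl c A p) ^ 2
      = ∑ p : Plaq P j, g p.src p.μ p.ν := Finset.sum_congr rfl fun p _ => hcurl p
    _ = ∑ x, ∑ μ, ∑ ν, if μ < ν then g x μ ν else 0 := sum_plaq_eq g
    _ = (1 / 2) * ∑ x, ∑ μ, ∑ ν, g x μ ν := by
        rw [Finset.mul_sum]
        refine Finset.sum_congr rfl fun x _ => ?_
        rw [key x]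
        ring

/-! ## 2. Second equality of (1.21): expanding the square -/

/-- **(1.21), second equality** p. 21 [PDF 5], verbatim: *"½ Σ_{x∈T_η,μ,ν} η^d |F_{μν}(x)|² = Σ_{x,μ,ν} η^d |(∂_μ A_ν)(x)|² −
Σ_{x,μ,ν} η^d (∂_μ A_ν)(x)(∂_ν A_μ)(x)"* (with `F_{μν} = ∂_μ A_ν − ∂_ν A_μ`, (1.2)). [cite: Balaban1984PropagatorsI, (1.21) p.21] -/
theorem half_sum_sq_eq_sq_sub_cross (w c : ℝ) (A : VecField P j ℝ) :
    (1 / 2) * ∑ x : Site P j, ∑ μ : Fin P.d, ∑ ν : Fin P.d,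
        w * (pdiff c μ (fun z => A ⟨z, ν⟩) x - pdiff c ν (fun z => A ⟨z, μ⟩) x) ^ 2
      = ∑ x : Site P j, ∑ μ : Fin P.d, ∑ ν : Fin P.d, w * (pdiff c μ (fun z => A ⟨z, ν⟩) x) ^ 2
        - ∑ x : Site P j, ∑ μ : Fin P.d, ∑ ν : Fin P.d,
            w * (pdiff c μ (fun z => A ⟨z, ν⟩) x * pdiff c ν (fun z => A ⟨z, μ⟩) x) := by
  set a : Site P j → Fin P.d → Fin P.d → ℝ := fun x μ ν => pdiff c μ (fun z => A ⟨z, ν⟩) x with ha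
  have hx : ∀ x : Site P j, ∑ μ, ∑ ν, w * (a x μ ν - a x ν μ) ^ 2
      = 2 * (∑ μ, ∑ ν, w * (a x μ ν) ^ 2) - 2 * ∑ μ, ∑ ν, w * (a x μ ν * a x ν μ) := by
    intro x
    have hswap : ∑ μ, ∑ ν, (a x ν μ) ^ 2 = ∑ μ, ∑ ν, (a x μ ν) ^ 2 := Finset.sum_comm
    have hterm : ∀ μ ν, w * (a x μ ν - a x ν μ) ^ 2
        = w * (a x μ ν) ^ 2 + w * (a x ν μ) ^ 2 - 2 * (w * (a x μ ν * a x ν μ)) := fun μ ν => by ring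
    simp only [hterm, Finset.sum_sub_distrib, Finset.sum_add_distrib, ← Finset.mul_sum]
    rw [hswap]
    ring
  change (1 / 2) * ∑ x, ∑ μ, ∑ ν, w * (a x μ ν - a x ν μ) ^ 2
      = ∑ x, ∑ μ, ∑ ν, w * (a x μ ν) ^ 2 - ∑ x, ∑ μ, ∑ ν, w * (a x μ ν * a x ν μ)
  rw [Finset.sum_congr rfl fun x _ => hx x, Finset.sum_sub_distrib, ← Finset.mul_sum, ← Finset.mul_sum]
  ring

/-! ## 3. Third equality of (1.21): `Σ_{x,μ,ν} η^d |(∂_μ A_ν)(x)|² = Σ_μ ⟨∂A_μ, ∂A_μ⟩` and, by summation by parts twice and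
`∂*_μ ∂_ν = ∂_ν ∂*_μ`, `Σ_{x,μ,ν} η^d (∂_μ A_ν)(x)(∂_ν A_μ)(x) = Σ_x η^d |Σ_μ (∂*_μ A_μ)(x)|²` -/

/-- **(1.21), third equality, square term** p. 21 [PDF 5], verbatim: *"Σ_{x,μ,ν} η^d |(∂_μ A_ν)(x)|² = Σ_μ ⟨∂A_μ, ∂A_μ⟩"* — the
gradient `∂A_ν` of the component `A_ν` as a bond field, `(∂A_ν)(⟨x, x + e_μ⟩) = (∂_μ A_ν)(x)`, paired with itself with the volume
element `η^d`. [cite: Balaban1984PropagatorsI, (1.21) p.21] -/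
theorem sum_sq_pdiff_eq_sum_bondPairing_grad (w c : ℝ) (A : VecField P j ℝ) :
    ∑ x : Site P j, ∑ μ : Fin P.d, ∑ ν : Fin P.d, w * (pdiff c μ (fun z => A ⟨z, ν⟩) x) ^ 2
      = ∑ ν : Fin P.d, bondPairing w (grad c fun z => A ⟨z, ν⟩) (grad c fun z => A ⟨z, ν⟩) := by
  have hb : ∀ ν : Fin P.d, bondPairing w (grad c fun z => A ⟨z, ν⟩) (grad c fun z => A ⟨z, ν⟩)
      = ∑ x : Site P j, ∑ μ : Fin P.d, w * (pdiff c μ (fun z => A ⟨z, ν⟩) x) ^ 2 := by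
    intro ν
    rw [bondPairing, sum_bond_eq]
    refine Finset.sum_congr rfl fun x _ => Finset.sum_congr rfl fun μ _ => ?_
    rw [grad_apply, sq]
  simp_rw [hb]
  calc ∑ x : Site P j, ∑ μ : Fin P.d, ∑ ν : Fin P.d, w * (pdiff c μ (fun z => A ⟨z, ν⟩) x) ^ 2
      = ∑ x : Site P j, ∑ ν : Fin P.d, ∑ μ : Fin P.d, w * (pdiff c μ (fun z => A ⟨z, ν⟩) x) ^ 2 :=
        Finset.sum_congr rfl fun x _ => Finset.sum_comm
    _ = ∑ ν : Fin P.d, ∑ x : Site P j, ∑ μ : Fin P.d, w * (pdiff c μ (fun z => A ⟨z, ν⟩) x) ^ 2 := Finset.sum_comm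

/-- **(1.21), third equality, cross term** p. 21 [PDF 5], verbatim: *"Σ_{x,μ,ν} η^d (∂_μ A_ν)(x)(∂_ν A_μ)(x) =
Σ_x η^d |Σ_μ (∂*_μ A_μ)(x)|²"* — by summation by parts on the torus twice, `Σ_x (∂_μ A_ν)(∂_ν A_μ) = Σ_x A_ν (∂*_μ ∂_ν A_μ) =
Σ_x A_ν (∂_ν ∂*_μ A_μ) = Σ_x (∂*_ν A_ν)(∂*_μ A_μ)`. [cite: Balaban1984PropagatorsI, (1.21) p.21] -/
theorem sum_cross_eq_sum_sq_diverg (w c : ℝ) (A : VecField P j ℝ) :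
    ∑ x : Site P j, ∑ μ : Fin P.d, ∑ ν : Fin P.d,
        w * (pdiff c μ (fun z => A ⟨z, ν⟩) x * pdiff c ν (fun z => A ⟨z, μ⟩) x)
      = ∑ x : Site P j, w * (∑ μ : Fin P.d, pdiffAdj c μ (fun z => A ⟨z, μ⟩) x) ^ 2 := by
  -- summation by parts twice, for each ordered pair `(μ, ν)`
  have hμν : ∀ μ ν : Fin P.d,
      ∑ x : Site P j, pdiff c μ (fun z => A ⟨z, ν⟩) x * pdiff c ν (fun z => A ⟨z, μ⟩) x
        = ∑ x : Site P j, pdiffAdj c μ (fun z => A ⟨z, μ⟩) x * pdiffAdj c ν (fun z => A ⟨z, ν⟩) x := by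
    intro μ ν
    have h1 := sum_pdiff_mul (P := P) (j := j) c μ (fun z => A ⟨z, ν⟩) (pdiff c ν fun z => A ⟨z, μ⟩)
    have h2 := sum_pdiff_mul (P := P) (j := j) c ν (pdiffAdj c μ fun z => A ⟨z, μ⟩) (fun z => A ⟨z, ν⟩)
    rw [h1, pdiffAdj_pdiff_comm, ← h2]
    exact Finset.sum_congr rfl fun x _ => mul_comm _ _
  -- the right-hand side as a triple sum
  have hR : ∑ x : Site P j, w * (∑ μ : Fin P.d, pdiffAdj c μ (fun z => A ⟨z, μ⟩) x) ^ 2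
      = ∑ μ : Fin P.d, ∑ ν : Fin P.d, w * ∑ x : Site P j,
          pdiffAdj c μ (fun z => A ⟨z, μ⟩) x * pdiffAdj c ν (fun z => A ⟨z, ν⟩) x := by
    calc ∑ x : Site P j, w * (∑ μ : Fin P.d, pdiffAdj c μ (fun z => A ⟨z, μ⟩) x) ^ 2
        = ∑ x : Site P j, ∑ μ : Fin P.d, ∑ ν : Fin P.d,
            w * (pdiffAdj c μ (fun z => A ⟨z, μ⟩) x * pdiffAdj c ν (fun z => A ⟨z, ν⟩) x) := by
          refine Finset.sum_congr rfl fun x _ => ?_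
          rw [sq, Finset.sum_mul_sum, Finset.mul_sum]
          simp_rw [Finset.mul_sum]
      _ = ∑ μ : Fin P.d, ∑ ν : Fin P.d, ∑ x : Site P j,
            w * (pdiffAdj c μ (fun z => A ⟨z, μ⟩) x * pdiffAdj c ν (fun z => A ⟨z, ν⟩) x) := by
          rw [Finset.sum_comm]
          exact Finset.sum_congr rfl fun μ _ => Finset.sum_comm
      _ = ∑ μ : Fin P.d, ∑ ν : Fin P.d, w * ∑ x : Site P j,
            pdiffAdj c μ (fun z => A ⟨z, μ⟩) x * pdiffAdj c ν (fun z => A ⟨z, ν⟩) x := by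
          simp_rw [Finset.mul_sum]
  rw [hR]
  calc ∑ x : Site P j, ∑ μ : Fin P.d, ∑ ν : Fin P.d,
        w * (pdiff c μ (fun z => A ⟨z, ν⟩) x * pdiff c ν (fun z => A ⟨z, μ⟩) x)
      = ∑ μ : Fin P.d, ∑ ν : Fin P.d, ∑ x : Site P j,
          w * (pdiff c μ (fun z => A ⟨z, ν⟩) x * pdiff c ν (fun z => A ⟨z, μ⟩) x) := by
        rw [Finset.sum_comm]
        exact Finset.sum_congr rfl fun μ _ => Finset.sum_comm
    _ = ∑ μ : Fin P.d, ∑ ν : Fin P.d, w * ∑ x : Site P j,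
          pdiffAdj c μ (fun z => A ⟨z, μ⟩) x * pdiffAdj c ν (fun z => A ⟨z, ν⟩) x := by
        refine Finset.sum_congr rfl fun μ _ => Finset.sum_congr rfl fun ν _ => ?_
        rw [← Finset.mul_sum, hμν]

/-! ## 4. Fourth equality of (1.21): `⟨∂A_μ, ∂A_μ⟩ = ⟨A_μ, ΔA_μ⟩` (`∂*` adjoint to `∂`, `∂*∂ = Δ`) and
`Σ_x η^d |Σ_μ (∂*_μ A_μ)(x)|² = ⟨∂*A, ∂*A⟩` (`∂*A = Σ_μ ∂*_μ A_μ`) -/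

/-- **(1.21), fourth equality, first term** p. 21 [PDF 5], verbatim: *"Σ_μ ⟨∂A_μ, ∂A_μ⟩ … = Σ_μ ⟨A_μ, ΔA_μ⟩ …, where Δ is η-lattice
Laplace operator for scalar functions"* — for every real scalar function `f` on the torus, `⟨∂f, ∂f⟩ = ⟨f, Δf⟩` with `Δ = ∂*∂ = Σ_μ ∂*_μ ∂_μ`.
[cite: Balaban1984PropagatorsI, (1.21) p.21] -/
theorem bondPairing_grad_eq_sitePairing_laplace (w c : ℝ) (f : SiteField P j ℝ) :
    bondPairing w (grad c f) (grad c f) = sitePairing w f (laplace c f) := by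
  unfold bondPairing sitePairing
  rw [← Finset.mul_sum, ← Finset.mul_sum, sum_grad_mul, diverg_grad]

/-- **(1.21), fourth equality, second term** p. 21 [PDF 5], verbatim: *"Σ_x η^d |Σ_μ (∂*_μ A_μ)(x)|² = ⟨∂*A, ∂*A⟩, … ∂* is the
divergence operator for vector functions, ∂*A = Σ_μ ∂*_μ A_μ"*. [cite: Balaban1984PropagatorsI, (1.21) p.21] -/
theorem sum_sq_diverg_eq_sitePairing (w c : ℝ) (A : VecField P j ℝ) :
    ∑ x : Site P j, w * (∑ μ : Fin P.d, pdiffAdj c μ (fun z => A ⟨z, μ⟩) x) ^ 2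
      = sitePairing w (diverg c A) (diverg c A) := by
  unfold sitePairing
  refine Finset.sum_congr rfl fun x _ => ?_
  rw [diverg_apply, sq]

/-! ## 5. The display (1.21) assembled -/

/-- **(1.21), first three equalities assembled** p. 21 [PDF 5]: *"⟨∂A, ∂A⟩ = … = Σ_μ ⟨∂A_μ, ∂A_μ⟩ − Σ_x η^d |Σ_μ (∂*_μ A_μ)(x)|²"*.
[cite: Balaban1984PropagatorsI, (1.21) p.21] -/
theorem pairing_curl_eq_sum_bondPairing_grad_sub (w c : ℝ) (A : VecField P j ℝ) :
    ∑ p : Plaq P j, w * (curl c A p) ^ 2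
      = ∑ ν : Fin P.d, bondPairing w (grad c fun z => A ⟨z, ν⟩) (grad c fun z => A ⟨z, ν⟩)
        - ∑ x : Site P j, w * (∑ μ : Fin P.d, pdiffAdj c μ (fun z => A ⟨z, μ⟩) x) ^ 2 := by
  rw [pairing_curl_eq_half_sum_sq, half_sum_sq_eq_sq_sub_cross, sum_sq_pdiff_eq_sum_bondPairing_grad,
    sum_cross_eq_sum_sq_diverg]

/-- **(1.21)** p. 21 [PDF 5], verbatim: *"⟨∂A, ∂A⟩ = ½ Σ_{x∈T_η,μ,ν} η^d |F_{μν}(x)|² = … = Σ_μ ⟨A_μ, ΔA_μ⟩ − ⟨∂*A, ∂*A⟩, where Δ is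
η-lattice Laplace operator for scalar functions and ∂* is the divergence operator for vector functions, ∂*A = Σ_μ ∂*_μ A_μ"* — typed
reading: for every real vector (bond) field `A` on the torus `T^{(j)}`, every lattice factor `c` and weight `w = η^d`,
`Σ_p η^d |(∂A)(p)|² = Σ_μ ⟨A_μ, ΔA_μ⟩ − ⟨∂*A, ∂*A⟩` with `Δ = Σ_μ ∂*_μ ∂_μ` (`LatticeFieldCalculus.laplace`) acting on the components
`A_μ` and `∂*` = `LatticeFieldCalculus.diverg`. [cite: Balaban1984PropagatorsI, (1.21) p.21] -/
theorem eq121 (w c : ℝ) (A : VecField P j ℝ) :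
    ∑ p : Plaq P j, w * (curl c A p) ^ 2
      = ∑ μ : Fin P.d, sitePairing w (fun z => A ⟨z, μ⟩) (laplace c fun z => A ⟨z, μ⟩)
        - sitePairing w (diverg c A) (diverg c A) := by
  rw [pairing_curl_eq_sum_bondPairing_grad_sub, sum_sq_diverg_eq_sitePairing]
  simp_rw [bondPairing_grad_eq_sitePairing_laplace]

/-- **(1.21) for the action (1.3)/(1.5)** p. 21 [PDF 5]: *"The action can be written as ⟨∂A, ∂A⟩ = … = Σ_μ ⟨A_μ, ΔA_μ⟩ − ⟨∂*A, ∂*A⟩"*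
— with `S^η(A) = ½ Σ_p η^d |(∂A)(p)|²` (`LatticeFieldCalculus.curlAction`), `2 S^η(A) = ⟨∂A, ∂A⟩ = Σ_μ ⟨A_μ, ΔA_μ⟩ − ⟨∂*A, ∂*A⟩`.
[cite: Balaban1984PropagatorsI, (1.21) p.21] -/
theorem two_mul_curlAction_eq (w c : ℝ) (A : VecField P j ℝ) :
    2 * curlAction w c A
      = ∑ μ : Fin P.d, sitePairing w (fun z => A ⟨z, μ⟩) (laplace c fun z => A ⟨z, μ⟩)
        - sitePairing w (diverg c A) (diverg c A) := by
  rw [← eq121, curlAction]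
  simp only [Real.norm_eq_abs, sq_abs]
  ring

end B5Eq121Form

end Literature.MathematicalPhysics.QuantumFieldTheory.Balaban1983to89
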